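import Summits.QuantumFields.GaugeBoot.ClassBLimitDiagonalGeometry
import Summits.QuantumFields.GaugeBoot.DiagonalRPTorusOdd
import HarnessLib

/-!
# Class B holds in two dimensions (gauge-boot, L3(ι), II)

HONEST FRAMING (cell `pub-gaugeboot`, page 1 of every file): the venture produces certified bounds
on lattice expectations at stated coupling, gauge group, dimension and torus size; NOT a mass gap,
NOT a continuum limit, NOT a string tension; NOT Yang–Mills-summit-bearing (barriers
`FixedCouplingUltralocality`, `PerturbativeInvisibility`). This module is a structural theorem
about the two-dimensional thermodynamic limit (which positivity families the limit states of the
two-dimensional torus Wilson states provably carry); it changes no certificate, and no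
two-dimensional certificate with a diagonal block exists or is planned.

## Content (`d = 2`, `G` compact metrisable, `ρ` continuous, every `β ≥ 0`)

* `DiagRPTwo.innerDiagonalRP_two_of_three_le` — inner-half diagonal RP holds on EVERY two-torus
  `(ℤ/L)²`, `L ≥ 3`: odd `L` by L3(θ) (`DiagRPTwo.diagonalReflectionPositive_two_odd`, even the
  closed half, `DiagonalRPTorusOdd.lean`), even `L ≥ 4` by L3(η) (`DiagRPTwo.innerDiagonalRP_two`,
  `DiagonalRPTorusInnerHalf.lean`);
* `diagRP_of_mem_infiniteVolumeLimitPoints_two`, `torusLimitPointsDiagonalRP_two :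
  TorusLimitPointsDiagonalRP 2 ρ β` — by the transfer of `ClassBLimitDiagonalGeometry.lean`
  (`diagRP_of_mem_infiniteVolumeLimitPoints_of_innerDiagonalRP`), every infinite-volume limit point
  of the two-dimensional torus Wilson states — along tori of either parity — is reflection positive
  in the diagonal mirrors;
* **`thermodynamicLimitIsClassB_two : ThermodynamicLimitIsClassB 2 ρ β`** — every such limit point
  is (the measure of) a Class-B state of `ClassB.lean` (`thermodynamicLimitIsClassB_iff`,
  `ClassBIdentification.lean`): the `d = 2` case of the identification the cell has carried as
  OPEN since `ClassB.lean` ("the torus states themselves violate diagonal RP at every `β`, so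
  nothing is inherited in the limit" — in two dimensions the violation lives on the back layer
  `y_i - y_j ≡ L/2`, which recedes to infinity, and everything else IS inherited);
* `exists_classBState_two`, `nonempty_classBState_two` — at every `β ≥ 0` a two-dimensional
  Class-B state exists, and is an infinite-volume limit point and a DLR state
  (`infiniteVolumeLimitPoints_nonempty_holds`,
  `mem_ymGibbsMeasures_of_mem_infiniteVolumeLimitPoints_holds`).

NOT claimed: `d ≥ 3` (inner-half diagonal RP of tori is open there; `TorusLimitPointsDiagonalRP d`,
`d ≥ 3`, stays OPEN), `β < 0`, uniqueness of the two-dimensional limit.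

References: K. Osterwalder, E. Seiler, Ann. Phys. 110 (1978) 440, §2; E. Seiler, LNP 159 (1982)
Ch. 2; J. Glimm, A. Jaffe, Quantum Physics (1987) §6.1; V. Kazakov, Z. Zheng, arXiv:2203.11360 §3.1.
-/

noncomputable section

open MeasureTheory
open scoped ComplexOrder ComplexConjugate
open Literature.MathematicalPhysics.QuantumLattice

namespace Summit.QuantumFields.GaugeBoot

variable {N : ℕ} {G : Type*} [Group G] [TopologicalSpace G] [IsTopologicalGroup G] [CompactSpace G]
  [MeasurableSpace G] [BorelSpace G] [T2Space G] [SecondCountableTopology G]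
  (ρ : G →* Matrix (Fin N) (Fin N) ℂ)

/-! ## Two dimensions: Class B at every `β ≥ 0` -/

section Two

omit [T2Space G] in
/-- **Inner-half diagonal RP holds on every two-torus `(ℤ/L)²` with `L ≥ 3`** (`β ≥ 0`): odd `L`
by L3(θ) (`DiagRPTwo.diagonalReflectionPositive_two_odd`, even the closed half), even `L ≥ 4` by
L3(η) (`DiagRPTwo.innerDiagonalRP_two`). -/
theorem DiagRPTwo.innerDiagonalRP_two_of_three_le {L : ℕ} [NeZero L] (h3 : 3 ≤ L)
    (hρ : Continuous ρ) {β : ℝ} (hβ : 0 ≤ β) {i j : Fin 2} (hij : i ≠ j) :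
    InnerDiagonalRP (d := 2) (L := L) ρ β i j := by
  rcases Nat.even_or_odd L with hL | hL
  · have h4 : 4 ≤ L := by obtain ⟨r, hr⟩ := hL; omega
    exact DiagRPTwo.innerDiagonalRP_two ρ hL h4 hρ hβ hij
  · exact (DiagRPTwo.diagonalReflectionPositive_two_odd ρ hL h3 hρ hβ
      hij).backInvariantDiagonalRP.innerDiagonalRP

/-- **Diagonal RP of two-dimensional torus limit points** (`β ≥ 0`, `i ≠ j`): every
infinite-volume limit point of the torus Wilson states of `ℤ²` is reflection positive in the
diagonal mirror `x_i = x_j` in the sense of `ClassB.lean`. -/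
theorem diagRP_of_mem_infiniteVolumeLimitPoints_two (hρ : Continuous ρ) {β : ℝ} (hβ : 0 ≤ β)
    {μ : Measure (LGConfig 2 G)} (hμ : μ ∈ infiniteVolumeLimitPoints (d := 2) ρ β) {i j : Fin 2}
    (hij : i ≠ j) : IsReflectionPositiveFor (configDiagSwapZd (G := G) i j) (diagHalfEdges i j) μ :=
  diagRP_of_mem_infiniteVolumeLimitPoints_of_innerDiagonalRP ρ hρ hμ
    ⟨2, fun _ hL => DiagRPTwo.innerDiagonalRP_two_of_three_le ρ (by omega) hρ hβ hij⟩

/-- **`TorusLimitPointsDiagonalRP` holds in two dimensions** (`β ≥ 0`). -/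
theorem torusLimitPointsDiagonalRP_two (hρ : Continuous ρ) {β : ℝ} (hβ : 0 ≤ β) :
    TorusLimitPointsDiagonalRP 2 ρ β :=
  fun _ hμ _ _ hij => diagRP_of_mem_infiniteVolumeLimitPoints_two ρ hρ hβ hμ hij

/-- **CLASS B HOLDS IN TWO DIMENSIONS** (`β ≥ 0`, compact second countable Hausdorff `G`,
continuous `ρ`): every infinite-volume limit point of the torus Wilson states of two-dimensional
lattice gauge theory is (the measure of) a Class-B state of `ClassB.lean` — translation and
hyperoctahedral invariance, the one-link Haar-shift identity, and reflection positivity in the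
site, link and diagonal mirrors. The `d = 2` case of the OPEN identification
`ThermodynamicLimitIsClassB`; `d ≥ 3` is not claimed. -/
theorem thermodynamicLimitIsClassB_two (hρ : Continuous ρ) {β : ℝ} (hβ : 0 ≤ β) :
    ThermodynamicLimitIsClassB 2 ρ β :=
  (thermodynamicLimitIsClassB_iff ρ hρ hβ).2 (torusLimitPointsDiagonalRP_two ρ hρ hβ)

/-- **Two-dimensional Class-B states exist at every `β ≥ 0` and are DLR states**: some
infinite-volume limit point of the torus Wilson states exists
(`infiniteVolumeLimitPoints_nonempty_holds`), is Class B (`thermodynamicLimitIsClassB_two`) and is a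
Gibbs measure of the Wilson specification
(`mem_ymGibbsMeasures_of_mem_infiniteVolumeLimitPoints_holds`). -/
theorem exists_classBState_two (hρ : Continuous ρ) {β : ℝ} (hβ : 0 ≤ β) :
    ∃ ω : ClassBState 2 ρ β,
      ω.μ ∈ infiniteVolumeLimitPoints (d := 2) ρ β ∧ ω.μ ∈ ymGibbsMeasures (d := 2) ρ β := by
  obtain ⟨μ, hμ⟩ := infiniteVolumeLimitPoints_nonempty_holds (d := 2) ρ hρ β
  obtain ⟨ω, hω⟩ := thermodynamicLimitIsClassB_two ρ hρ hβ μ hμ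
  exact ⟨ω, hω ▸ hμ, hω ▸ mem_ymGibbsMeasures_of_mem_infiniteVolumeLimitPoints_holds ρ hρ hμ⟩

/-- `ClassBState 2 ρ β` is inhabited at every `β ≥ 0`. -/
theorem nonempty_classBState_two (hρ : Continuous ρ) {β : ℝ} (hβ : 0 ≤ β) :
    Nonempty (ClassBState 2 ρ β) :=
  let ⟨ω, _⟩ := exists_classBState_two ρ hρ hβ
  ⟨ω⟩

end Two

end Summit.QuantumFields.GaugeBoot
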